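import Summits.RiemannHypothesis.RiemannHypothesis.Theorems.GroundBartaEvenWinsBeyondArchDeflationRitz
import Literature.NumberTheory.LFunctions.WeilThreePrimeSliver
import Literature.NumberTheory.LFunctions.WeilDeflationPenaltyPoly
import HarnessLib

/-!
# RiemannHypothesis / GroundBarta — rung 4 (`EvenWinsBeyondArch`, stmt-RiemannHypothesis-18807):
# the deflated Temple L-side, bridge from a rank-one augmented two-prime certificate (odd sector)

Helper file (`--supports stmt-RiemannHypothesis-18807`), RH-free, no definitions, no named facts.

The β-certificates of the deflated Temple / Lehmann–Maehly L-sides are generated in the format of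
`Literature/…/WeilTwoPrimeCertificateDeflated{,OK}.lean`: a rank-one augmented moment certificate with penalty data
`R : List (ℚ × ℕ × List ℚ)` at half-width `a₀` proves

  `β₂₃ ‖g‖₂² ≤ E₂₃(g) + Σ_{r ∈ R} μ_r |Σ_{k<n} ĉ_{rk} M_k(g)|²`,  `M_k(g) = ∫ g(x)(x/a₀)^k dx`,

for the (odd) test functions on `[-a₀, a₀]` (e.g. `deflBound_weilCertDeflM72`, `a₀ = 18/25`, `β₂₃ = 17/25`, six odd penalties).
THIS FILE turns such a conclusion — taken as a HYPOTHESIS `hcert23`, so that it serves every certificate of the format — into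
the complement certificate `hcert` of `dt_weilOddGroundEnergy_ge_of_ritz` for the TRUE form on a window `c ≤ a₀` with
`c ≤ (log 5)/2`, via the sliver bound `E₂₃(g) − (log 2)/2 · ‖g‖₂² ≤ Re Q(g)` (`weilTwoPrimeQuadratic_sub_le_weilQuadratic_re`):
the trial vectors are the penalty polynomials `p_r = maskPoly r n a₀` themselves (`v_r = 𝟙_{[-c,c]} · p_r`), the complement level is
`β = β₂₃ − (log 2)/2`, and what remains is the `k × k` PSD datum `hPSD` of B's theorem (entries: explicit integrals of the `p_r`).

* `dt_list_sum_map_eq_sum_get` — `(R.map f).sum = Σ_{i : Fin R.length} f (R.get i)`;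
* `dt_rankOne_term_eq` — `|Σ_k ĉ_k M_k(φ)|² = |∫ φ · conj v|²` for `v = 𝟙_{[-c,c]} · maskPoly`, `tsupport φ ⊆ [-c, c]`;
* **`dt_weilOddGroundEnergy_ge_of_deflCert`** — certificate conclusion + sliver + `hPSD` ⇒ `λ ≤ ε_od(c)`.

Prover A (unit `sr-gb-rung-a-g2`); consumer of prover B's `dt_weilOddGroundEnergy_ge_of_ritz` (file IX).
-/

set_option linter.dupNamespace false

noncomputable section

open MeasureTheory Set Filter
open scoped Topology ComplexConjugate BigOperators

namespace Summit.RiemannHypothesis.RiemannHypothesis.Theorems.EvenWinsBeyondArch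

open Literature.NumberTheory.LFunctions
open Summit.RiemannHypothesis.RiemannHypothesis.Theorems.OddSector (weilDirichletEnergy₂ weilPoleForm₂)

/-- A list sum over `R.map f` as a sum over `Fin R.length`. [folklore] -/
theorem dt_list_sum_map_eq_sum_get {α : Type*} : ∀ (R : List α) (f : α → ℝ),
    (R.map f).sum = ∑ i : Fin R.length, f (R.get i)
  | [], f => by simp
  | a :: R, f => by
      rw [List.map_cons, List.sum_cons, dt_list_sum_map_eq_sum_get R f]
      simp [Fin.sum_univ_succ]

/-- For `tsupport φ ⊆ [-c, c]` the windowed penalty polynomial pairs with `φ` like the bare polynomial: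
`∫ φ · p = ∫ φ · conj (𝟙_{[-c,c]} p)` (real `p`). [folklore] -/
theorem dt_integral_mul_poly_eq_integral_mul_conj_indicator {φ : ℝ → ℂ} {c : ℝ} (hφs : tsupport φ ⊆ Icc (-c) c)
    (p : ℝ → ℝ) :
    ∫ x, φ x * (p x : ℂ) = ∫ x, φ x * conj ((((Icc (-c) c).indicator p x : ℝ) : ℂ)) := by
  refine integral_congr_ae (Eventually.of_forall fun x ↦ ?_)
  simp only [Complex.conj_ofReal]
  by_cases hx : x ∈ Icc (-c) c
  · rw [indicator_of_mem hx]
  · have hφ : φ x = 0 := image_eq_zero_of_notMem_tsupport fun h ↦ hx (hφs h)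
    rw [hφ, zero_mul, zero_mul]

/-- **One rank-one term of the certificate, rewritten as a pairing with the windowed penalty polynomial**:
`|Σ_{k<n} ĉ_k M_k(φ)|² = |∫ φ · conj (𝟙_{[-c,c]} · maskPoly r n a₀)|²` for `tsupport φ ⊆ [-c, c]`. [folklore] -/
theorem dt_rankOne_term_eq (r : ℚ × ℕ × List ℚ) (n : ℕ) (a₀ : ℝ) {φ : ℝ → ℂ} (hφ : IsWeilTest φ) {c : ℝ}
    (hφs : tsupport φ ⊆ Icc (-c) c) :
    ‖∑ k ∈ Finset.range n, ((maskV r k : ℚ) : ℂ) * weilMoment a₀ φ k‖ ^ 2 =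
      ‖∫ x, φ x * conj ((((Icc (-c) c).indicator (fun x ↦ maskPoly r n a₀ x) x : ℝ) : ℂ))‖ ^ 2 := by
  rw [sum_maskV_mul_weilMoment r n a₀ hφ, dt_integral_mul_poly_eq_integral_mul_conj_indicator hφs]

/-- **The deflated Temple odd-sector bound from a rank-one augmented two-prime certificate** (any window
`0 < c ≤ a₀`, `c ≤ (log 5)/2`).  Hypotheses: the certificate's conclusion `hcert23` on the odd tests of `[-a₀, a₀]`
(level `β₂₃`, penalty data `R` of odd parity with non-negative weights, moments of order `< n`), `λ < β₂₃ − (log 2)/2`, and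
the `k × k` PSD datum of `dt_weilOddGroundEnergy_ge_of_ritz` for the trial vectors `v_i = 𝟙_{[-c,c]} · maskPoly (R_i) n a₀`
(explicit window images `F_i`, any coefficient matrix `W`).  Conclusion: `λ ≤ ε_od(c)`. [folklore] -/
theorem dt_weilOddGroundEnergy_ge_of_deflCert {c : ℝ} (hc : 0 < c) (hc5 : c ≤ Real.log 5 / 2)
    {a₀ : ℝ} (hca : c ≤ a₀) (R : List (ℚ × ℕ × List ℚ)) (n : ℕ) {β₂₃ : ℝ}
    (hRodd : ∀ i : Fin R.length, (R.get i).2.1 % 2 = 1) (hRμ : ∀ i : Fin R.length, 0 ≤ (R.get i).1)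
    (hcert23 : ∀ g : ℝ → ℂ, IsWeilTest g → tsupport g ⊆ Icc (-a₀) a₀ → (∀ x, g (-x) = -g x) →
      β₂₃ * weilNorm2Sq g ≤ weilTwoPrimeQuadratic g +
        (R.map fun r ↦ (r.1 : ℝ) * ‖∑ k ∈ Finset.range n, ((maskV r k : ℚ) : ℂ) * weilMoment a₀ g k‖ ^ 2).sum)
    (v F : Fin R.length → ℝ → ℂ)
    (hv : ∀ i x, v i x = (((Icc (-c) c).indicator (fun x ↦ maskPoly (R.get i) n a₀ x) x : ℝ) : ℂ))
    (hF : ∀ i y, F i y = (Icc (-c) c).indicator (fun y ↦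
        2 * (∫ x, v i x * (Real.cosh (x / 2) : ℂ)) * (Real.cosh (y / 2) : ℂ) -
          2 * (∫ x, v i x * (Real.sinh (x / 2) : ℂ)) * (Real.sinh (y / 2) : ℂ) +
        (∑ m ∈ weilPrimeIndex c, (((ArithmeticFunction.vonMangoldt m : ℝ) / Real.sqrt m : ℝ) : ℂ) *
          (2 * v i y - v i (y - Real.log m) - v i (y + Real.log m))) +
        ∫ t in Ioi 0, (weilArchDensity t : ℂ) * (2 * v i y - v i (y - t) - v i (y + t))) y -
      (weilMarkovConstant c : ℂ) * v i y)
    (W : Fin R.length → Fin R.length → ℝ) {lam : ℝ} (hlam : lam < β₂₃ - Real.log 2 / 2)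
    (hPSD : ∀ α : Fin R.length → ℝ, 0 ≤ ∑ i, ∑ j, α i * α j *
      ((β₂₃ - Real.log 2 / 2 - lam) * ((weilPoleForm₂ (v i) (v j) + weilDirichletEnergy₂ c (v i) (v j) -
          weilMarkovConstant c * ∫ x, (v i x * conj (v j x)).re) - lam * ∫ x, (v i x * conj (v j x)).re) -
        ∫ x, ((F i - ∑ l, W i l • v l) x * conj ((F j - ∑ l, W j l • v l) x)).re)) :
    lam ≤ weilOddGroundEnergy c := by
  refine dt_weilOddGroundEnergy_ge_of_ritz hc (fun i x ↦ maskPoly (R.get i) n a₀ x)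
    (fun i ↦ contDiff_maskPoly (R.get i) n a₀) (fun i x ↦ maskPoly_neg_of_odd (R.get i) (hRodd i) n a₀ x)
    v F hv hF W (fun i ↦ ((R.get i).1 : ℝ)) hlam (fun i ↦ by exact_mod_cast hRμ i) ?_ hPSD
  intro φ hφ hφs hφo
  have hφa : tsupport φ ⊆ Icc (-a₀) a₀ := hφs.trans (Icc_subset_Icc (by linarith) hca)
  have h23 := hcert23 φ hφ hφa hφo
  have hsl := weilTwoPrimeQuadratic_sub_le_weilQuadratic_re hφ hφs hc5
  have hsum : (R.map fun r ↦ (r.1 : ℝ) * ‖∑ k ∈ Finset.range n, ((maskV r k : ℚ) : ℂ) * weilMoment a₀ φ k‖ ^ 2).sum =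
      ∑ i : Fin R.length, ((R.get i).1 : ℝ) * ‖∫ x, φ x * conj (v i x)‖ ^ 2 := by
    rw [dt_list_sum_map_eq_sum_get]
    refine Finset.sum_congr rfl fun i _ ↦ ?_
    rw [dt_rankOne_term_eq (R.get i) n a₀ hφ hφs]
    simp only [hv i]
  have hn : weilNorm2Sq φ = ∫ x, ‖φ x‖ ^ 2 := rfl
  rw [hsum, hn] at h23
  rw [hn] at hsl
  linarith

end Summit.RiemannHypothesis.RiemannHypothesis.Theorems.EvenWinsBeyondArch

end
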